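import Summits.Ventures.YMGap.RobustBall.BallClosure
import Summits.Ventures.YMGap.RobustBall.AxialPairWitness
import Summits.Ventures.YMGap.RobustBall.RowsS
import HarnessLib

/-!
# Venture YMGap, track ROBUST-BALL (tier 2) — superposed members inside one certified row

HONEST FRAMING. WHAT THIS IS: a venture file (cell `pub-ymgap`, track Y2 ROBUST-BALL, seat rb-p1): a worked
instance of the closure theorems of `BallClosure.lean`. The mixed perturbation
`adjointWitness t + axialPairWitness 2 τ (1/10)` — Bhanot–Creutz-type adjoint plaquette terms `t (Re tr U_p/2)²`
(tier 1, range `1`, put into the weighted ball by `MemBallZd.memBallZdS`) PLUS the infinite-range axial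
plaquette-pair couplings `τ (1/10)^{dist} (Re tr U_p/2)(Re tr U_q/2)` — lies, by `MemBallZdS.add`, in the
weighted ball with the SUM of the two loads, hence inside row `su2_rowS32_1_16` for `|t| ≤ 1/1000`,
`|τ| ≤ 1/500`: `SU(2)` on `ℤ⁴` at `β_W = 1/16` so perturbed has exactly one DLR state clustering at rate
`log (3/2)` (`su2_adjoint_add_axialPair_massGapS_1_16`; loads `a ≤ 0.0274 ≤ 0.372`, `Λ ≤ 0.1681 ≤ 0.186`).
WHAT IT IS NOT: a strong-coupling lattice statement; nothing about the continuum limit or the Clay problem.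

References: `BallClosure.lean`, `AdjointWitness.lean`, `AxialPairWitness.lean`, `RowsS.lean` (this track).
-/

noncomputable section

open MeasureTheory Filter Function Topology Real
open Literature.Probability.LatticeModels
open Literature.MathematicalPhysics.QuantumLattice
open Literature.MathematicalPhysics.QuantumFieldTheory hiding ZdEdge

namespace Summit.Ventures.YMGap.RobustBall

/-- The adjoint witness in the weighted ball at weight `t₀ ≥ 0` on `ℤ⁴`, `SU(2)`:
loads `(6|t|, e^{t₀} · 48|t|/√2)` (tier-1 loads `(6|t|, 48|t|/√2)`, range `1`). -/
theorem memBallZdS_adjointWitness_dim4 (t : ℝ) {t₀ : ℝ} (ht₀ : 0 ≤ t₀) :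
    MemBallZdS (6 * |t|) (exp t₀ * (48 * |t| / Real.sqrt 2)) t₀ (adjointWitness (d := 4) (N := 2) t) := by
  have h := (memBallZd_adjointWitness (d := 4) (N := 2) (by norm_num) (by norm_num) t).memBallZdS ht₀
  rw [mul_one] at h
  refine h.mono (le_of_eq ?_) (le_of_eq ?_)
  · push_cast; ring
  · push_cast; ring

/-- **Superposed member row**: `SU(2)`, `ℤ⁴`, `β_W = 1/16`, perturbation `adjointWitness t + axialPairWitness 2 τ (1/10)`
with `|t| ≤ 1/1000`, `|τ| ≤ 1/500`: exactly one DLR state, clustering at rate `log (3/2)` — inside row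
`su2_rowS32_1_16` by ADDING the loads of the two members (`MemBallZdS.add`). -/
theorem su2_adjoint_add_axialPair_massGapS_1_16 {t τ : ℝ} (ht : |t| ≤ 1 / 1000) (hτ : |τ| ≤ 1 / 500) :
    PerturbedMassGapAtS 4 2 ((1 / 16 : ℝ) / 4)
      (adjointWitness (d := 4) (N := 2) t + axialPairWitness (d := 4) 2 τ (1 / 10)) := by
  have hq : exp (Real.log (3 / 2)) = 3 / 2 := Real.exp_log (by norm_num)
  have hlog0 : 0 ≤ Real.log (3 / 2) := Real.log_nonneg (by norm_num)
  have hadj := memBallZdS_adjointWitness_dim4 t hlog0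
  have hax := memBallZdS_axialPairWitness (d := 4) (N := 2) (τ := τ) (κ := 1 / 10) (t := Real.log (3 / 2))
    (by norm_num) (by norm_num) (by norm_num) (by norm_num) hlog0 (by rw [hq]; norm_num)
  have hsum := hadj.add hax
  rw [hq] at hsum
  have hs := sqrt_two_ge
  have hs0 : (0 : ℝ) < Real.sqrt 2 := by linarith
  have ht0 : 0 ≤ |t| := abs_nonneg t
  have hτ0 : 0 ≤ |τ| := abs_nonneg τ
  have hdivt : |t| / Real.sqrt 2 ≤ (1 / 1000) / (141421 / 100000) := div_le_div₀ (by norm_num) ht (by norm_num) hs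
  have hdivτ : |τ| / Real.sqrt 2 ≤ (1 / 500) / (141421 / 100000) := div_le_div₀ (by norm_num) hτ (by norm_num) hs
  refine su2_rowS32_1_16 _ (hsum.mono ?_ ?_)
  · push_cast; nlinarith
  · push_cast
    have heq : (3 : ℝ) / 2 * (48 * |t| / Real.sqrt 2) +
        16 * 4 * (4 - 1) * (|τ| / Real.sqrt 2) * (3 / 2) *
          (1 / 10 / (1 - 1 / 10) + 1 / 10 * (3 / 2) / (1 - 1 / 10 * (3 / 2))) =
        72 * (|t| / Real.sqrt 2) +
        16 * 4 * (4 - 1) * (3 / 2) * (1 / 10 / (1 - 1 / 10) + 1 / 10 * (3 / 2) / (1 - 1 / 10 * (3 / 2))) *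
          (|τ| / Real.sqrt 2) := by ring
    rw [heq]
    nlinarith [hdivt, hdivτ, div_nonneg ht0 hs0.le, div_nonneg hτ0 hs0.le]

end Summit.Ventures.YMGap.RobustBall
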